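import Summits.CriticalPhenomena.SAWScalingLimit.Theorems.SAWCompassLatticeCompassSLEYbSubseqLimitChordal
import Literature.Probability.RandomPlanarGeometry.PolylineSimple

/-!
# A simplicity criterion for polylines (lattice input of stub I2b of crux `CompassSLE`,
# stmt-CriticalPhenomena-6965, line `registered` = `birth`, lead c6; file 1 of 3)

A polyline through finitely many vertices of a real normed space, with distinct consecutive
vertices and distinct first and last vertex, whose segments pairwise meet at most in the point
"end of the earlier = start of the later", is a SIMPLE curve class (`CurveClass.simple`):

* `isFlat_trans` — gluing: if `γ : Path x y` is injective, `γ' : Path y z` is flat (a return to a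
  value forces constancy in between, cf. `Curve.IsFlat`) and every common value of `γ` and `γ'` is
  the junction point `y`, then `γ.trans γ'` is flat;
* `range_polylineFrom_subset` — the range of a polyline lies in its first vertex and its segments;
* `isFlat_polylineFrom` — the dyadic parametrisation `polylineFrom` of such a polyline is flat;
* `mk_polyline_mem_simple_of_pairwise` — hence (monotone–light factorisation
  `Curve.exists_isSimple_of_isFlat` of `SimpleCurves.lean`) its class is simple;
* `stub_ybPolylineSimpleCriterion` — the planar case, registered piece of the skeleton.

Used by `…CompassSLEYbLatticeSimple.lean` (Glazman–Manolescu `π/2` walks are drawn as simple curves)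
and `…CompassSLEYbSubseqLimitClosureSimple.lean` (subsequential limits are carried by
`closure CurveClass.simple`). Elementary real-variable bookkeeping on `Path.trans`/`Path.segment`
(Aizenman–Burchard 1999, §2.1: curves modulo reparametrisation; Camia–Newman 2007, §2: lattice paths as
polygonal curves); tagged [folklore]. No named fact is used.
-/

noncomputable section

namespace Summit.CriticalPhenomena.SAWScalingLimit.Theorems.SAWCompassLatticeCompassSLE

open MeasureTheory Filter Topology Set Metric
open scoped NNReal ENNReal unitInterval
open Literature.Probability.RandomPlanarGeometry
open Literature.Probability.LatticeModels (polyline polylineFrom polylineFrom_nil polylineFrom_cons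
  mem_range_polyline)

namespace LatticeSimple

/-! ### Part 1: a simplicity criterion for polylines -/

section General

variable {E : Type*} [NormedAddCommGroup E] [NormedSpace ℝ E]

omit [NormedSpace ℝ E] in
/-- **Gluing flat paths.** If `γ : Path x y` is injective, `γ' : Path y z` is flat (a return to a
value forces constancy in between) and every common value of `γ` and `γ'` is the junction point
`y`, then the concatenation `γ.trans γ'` is flat. [folklore] -/
theorem isFlat_trans {x y z : E} (γ : Path x y) (γ' : Path y z) (hγ : Function.Injective γ)
    (hγ' : ∀ s u t : I, s ≤ u → u ≤ t → γ' s = γ' t → γ' u = γ' s)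
    (hmeet : ∀ s t : I, γ s = γ' t → γ s = y) :
    ∀ s u t : I, s ≤ u → u ≤ t → γ.trans γ' s = γ.trans γ' t → γ.trans γ' u = γ.trans γ' s := by
  intro s u t hsu hut hst
  have hs0 := s.2.1; have hs1 := s.2.2; have hu0 := u.2.1; have hu1 := u.2.2
  have ht0 := t.2.1; have ht1 := t.2.2
  have hsu' : (s : ℝ) ≤ u := hsu
  have hut' : (u : ℝ) ≤ t := hut
  simp only [Path.trans_apply] at hst ⊢
  by_cases ht : (t : ℝ) ≤ 1 / 2
  · -- everything happens on `γ`, which is injective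
    have hu : (u : ℝ) ≤ 1 / 2 := hut'.trans ht
    have hs : (s : ℝ) ≤ 1 / 2 := hsu'.trans hu
    rw [dif_pos hs, dif_pos ht] at hst
    have := congrArg (fun v : I => (v : ℝ)) (hγ hst)
    simp only at this
    have hsueq : (s : ℝ) = u := by linarith
    rw [dif_pos hu, dif_pos hs]
    congr 1
    exact Subtype.ext (by simp [hsueq])
  · rw [not_le] at ht
    by_cases hs : (s : ℝ) ≤ 1 / 2
    · -- `s` on `γ`, `t` on `γ'`: the common value is `y`, so `s = 1/2` and `γ'` is pinned at `y`
      rw [dif_pos hs, dif_neg (not_le.2 ht)] at hst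
      have hy : γ ⟨2 * s, _⟩ = y := hmeet _ _ hst
      have hs12 : (s : ℝ) = 1 / 2 := by
        have h1 : γ ⟨2 * s, (unitInterval.mul_pos_mem_iff zero_lt_two).2 ⟨s.2.1, hs⟩⟩ = γ 1 := by
          rw [hy, γ.target]
        have := congrArg (fun v : I => (v : ℝ)) (hγ h1)
        simp only [Set.Icc.coe_one] at this
        linarith
      by_cases hu : (u : ℝ) ≤ 1 / 2
      · have hsueq : (s : ℝ) = u := by linarith
        rw [dif_pos hu, dif_pos hs]
        congr 1
        exact Subtype.ext (by simp [hsueq])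
      · rw [not_le] at hu
        rw [dif_neg (not_le.2 hu), dif_pos hs, hy]
        -- `γ' 0 = y = γ' (2t-1)` and `0 ≤ 2u-1 ≤ 2t-1`
        have h0 : γ' 0 = γ' ⟨2 * t - 1, unitInterval.two_mul_sub_one_mem_iff.2 ⟨ht.le, t.2.2⟩⟩ := by
          rw [γ'.source, ← hst, hy]
        have key := hγ' 0 ⟨2 * u - 1, unitInterval.two_mul_sub_one_mem_iff.2 ⟨hu.le, u.2.2⟩⟩
          ⟨2 * t - 1, unitInterval.two_mul_sub_one_mem_iff.2 ⟨ht.le, t.2.2⟩⟩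
          (Subtype.mk_le_mk.2 (by simp; linarith)) (Subtype.mk_le_mk.2 (by linarith)) h0
        rw [key, γ'.source]
    · -- everything happens on `γ'`, which is flat
      rw [not_le] at hs
      have hu : (1 / 2 : ℝ) < u := hs.trans_le hsu'
      rw [dif_neg (not_le.2 hs), dif_neg (not_le.2 ht)] at hst
      rw [dif_neg (not_le.2 hu), dif_neg (not_le.2 hs)]
      exact hγ' _ _ _ (Subtype.mk_le_mk.2 (by linarith)) (Subtype.mk_le_mk.2 (by linarith)) hst

/-- A straight segment between distinct points is injective. [folklore] -/
theorem injective_segment {a b : E} (hab : a ≠ b) : Function.Injective (Path.segment a b) := by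
  intro s t hst
  simp only [Path.segment_apply, AffineMap.lineMap_apply_module] at hst
  have h : ((s : ℝ) - (t : ℝ)) • (b - a) = 0 := by
    rw [sub_smul]
    have : (1 - (s : ℝ)) • a + (s : ℝ) • b - ((1 - (t : ℝ)) • a + (t : ℝ) • b) = 0 := sub_eq_zero.2 hst
    rw [← this]
    module
  rcases smul_eq_zero.1 h with h | h
  · exact Subtype.ext (sub_eq_zero.1 h)
  · exact absurd (sub_eq_zero.1 h).symm hab

/-- **The range of a polyline lies in its first vertex and its segments.** [folklore] -/
theorem range_polylineFrom_subset : ∀ (l : List E) (a : E),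
    Set.range (polylineFrom a l).2 ⊆ {a} ∪ ⋃ q ∈ (a :: l).zip l, segment ℝ q.1 q.2
  | [], a => by
    rintro _ ⟨t, rfl⟩
    exact Or.inl rfl
  | b :: l, a => by
    rw [polylineFrom_cons, Path.trans_range, Set.union_subset_iff, Path.range_segment]
    constructor
    · intro z hz
      refine Or.inr (Set.mem_iUnion₂.2 ⟨(a, b), ?_, hz⟩)
      simp
    · intro z hz
      rcases range_polylineFrom_subset l b hz with h | h
      · refine Or.inr (Set.mem_iUnion₂.2 ⟨(a, b), by simp, ?_⟩)
        rw [Set.mem_singleton_iff.1 h]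
        exact right_mem_segment ℝ a b
      · obtain ⟨q, hq, hzq⟩ := Set.mem_iUnion₂.1 h
        refine Or.inr (Set.mem_iUnion₂.2 ⟨q, ?_, hzq⟩)
        simp only [List.zip_cons_cons, List.mem_cons]
        exact Or.inr hq

/-- **A polyline whose segments pairwise meet at most in "end of the earlier = start of the later"
(and whose consecutive vertices are distinct) is flat.** [folklore] -/
theorem isFlat_polylineFrom : ∀ (l : List E) (a : E), List.IsChain (· ≠ ·) (a :: l) →
    ((a :: l).zip l).Pairwise (fun p q => segment ℝ p.1 p.2 ∩ segment ℝ q.1 q.2 ⊆ {p.2} ∩ {q.1}) →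
    ∀ s u t : I, s ≤ u → u ≤ t → (polylineFrom a l).2 s = (polylineFrom a l).2 t →
      (polylineFrom a l).2 u = (polylineFrom a l).2 s
  | [], a => by
    intro _ _ s u t _ _ _
    rfl
  | b :: l, a => by
    intro hchain hpair
    rw [List.isChain_cons_cons] at hchain
    simp only [List.zip_cons_cons, List.pairwise_cons] at hpair
    obtain ⟨hab, hchain'⟩ := hchain
    obtain ⟨hfirst, hpair'⟩ := hpair
    rw [polylineFrom_cons]
    refine isFlat_trans (Path.segment a b) (polylineFrom b l).2 (injective_segment hab)
      (isFlat_polylineFrom l b hchain' hpair') ?_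
    intro s t hst
    have hs : Path.segment a b s ∈ segment ℝ a b := by
      rw [← Path.range_segment a b]
      exact Set.mem_range_self s
    rcases range_polylineFrom_subset l b ⟨t, hst.symm⟩ with h | h
    · exact Set.mem_singleton_iff.1 h
    · obtain ⟨q, hq, hzq⟩ := Set.mem_iUnion₂.1 h
      have := hfirst q hq ⟨hs, hzq⟩
      exact Set.mem_singleton_iff.1 this.1

/-- **Simplicity criterion for polylines.** A polyline with at least one segment, consecutive
vertices distinct, distinct first and last vertex, whose segments pairwise meet at most in "end
of the earlier = start of the later", is a SIMPLE curve class. [folklore] -/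
theorem mk_polyline_mem_simple_of_pairwise (a b : E) (l : List E)
    (hchain : List.IsChain (· ≠ ·) (a :: b :: l))
    (hpair : ((a :: b :: l).zip (b :: l)).Pairwise
      (fun p q => segment ℝ p.1 p.2 ∩ segment ℝ q.1 q.2 ⊆ {p.2} ∩ {q.1}))
    (hlast : a ≠ (a :: b :: l).getLast (List.cons_ne_nil _ _)) :
    CurveClass.mk ⟨polyline (a :: b :: l)⟩ ∈ (CurveClass.simple : Set (CurveClass E)) := by
  set γ : Curve E := ⟨polyline (a :: b :: l)⟩ with hγ
  have hγt : ∀ t, γ t = (polylineFrom a (b :: l)).2 t := fun t => rfl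
  have hflat : γ.IsFlat := by
    intro s u t hsu hut hst
    rw [hγt, hγt] at hst ⊢
    exact isFlat_polylineFrom (b :: l) a hchain hpair s u t hsu hut hst
  have h01 : γ 0 ≠ γ 1 := by
    rw [hγt, hγt, Path.source, Path.target, Literature.Probability.LatticeModels.polylineFrom_fst]
    exact hlast
  obtain ⟨γ₀, hγ₀, -, hdist⟩ := Curve.exists_isSimple_of_isFlat hflat h01
  rw [CurveClass.mk_eq_mk_iff_dist_eq_zero.2 hdist]
  exact CurveClass.mk_mem_simple hγ₀

end General

end LatticeSimple

open LatticeSimple in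
/-- **Registered piece `stub_ybPolylineSimpleCriterion` of the `CompassSLE` skeleton (planar polyline
simplicity criterion).** A planar polyline with distinct consecutive vertices, distinct first and last
vertex, whose segments pairwise meet at most in "end of the earlier = start of the later", is a simple
curve class. [folklore] -/
theorem stub_ybPolylineSimpleCriterion :
    ∀ (a b : ℂ) (l : List ℂ), List.IsChain (· ≠ ·) (a :: b :: l) →
      ((a :: b :: l).zip (b :: l)).Pairwise
        (fun p q => segment ℝ p.1 p.2 ∩ segment ℝ q.1 q.2 ⊆ {p.2} ∩ {q.1}) →
      a ≠ (a :: b :: l).getLast (List.cons_ne_nil _ _) →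
      CurveClass.mk ⟨polyline (a :: b :: l)⟩ ∈ (CurveClass.simple : Set (CurveClass ℂ)) :=
  fun a b l h1 h2 h3 => mk_polyline_mem_simple_of_pairwise a b l h1 h2 h3

end Summit.CriticalPhenomena.SAWScalingLimit.Theorems.SAWCompassLatticeCompassSLE

end
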